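import Mathlib

/-!
# Route TwistAmplification — support item `TwistAmplificationLemma` (stmt-ABC-1978):
  real-exponent bookkeeping of the twist amplification

Helper file for the proof of `Summit.ABC.ABC.Theses.TwistAmplification.TwistAmplificationLemma`.
For a violator with conductor `N` and size `M > N^{σ'}` the prime twists by `p` have conductor
`N p²` and size `p⁶ M`; they sit in the window `[κ, σ]` exactly for
`Y₁ := (M/N^σ)^{1/(2σ−6)} ≤ p ≤ Y := (M/N^κ)^{1/(2κ−6)}` (`upper_edge`, `lower_edge`).
The range is wide (`separation`: `N^{(σ−κ)/(2κ−6)} Y₁ ≤ Y`), `Y` is large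
(`rpow_le_upper`: `N^{(σ'−κ)/(2κ−6)} ≤ Y`), the conductor scale `X = N Y²` is a bounded power of
`Y` (`base_le_rpow_upper`, `scale_le_rpow_upper`: `X ≤ Y^ν`, `ν = 2 + (2κ−6)/(σ'−κ)`), and the
saving exponent transported to `Y` is `< 1` (`saving_exponent_lt_one`: `max δ 0 · ν < 1` iff, for
`δ > 0`, `δ < (σ'−κ)/(2σ'−6)`, which holds as `s ↦ (s−κ)/(2s−6)` increases for `κ > 3`).
Finally `eventually_count_lt` is the elementary growth fact `E + C Y^λ < Y/(8 log Y)` for large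
`Y` (`λ < 1`), and `rpow_le_div_eight_pow` bounds the few twisting primes dividing `N`.
Pure real analysis; no arithmetic input.
-/

-- `Summit.<Summit>.<Problem>` is the mandated summit-side namespace (CONVENTIONS §2); for the
-- single-conjunct summit `ABC` the two coincide, so the duplicate `ABC.ABC` is deliberate.
set_option linter.dupNamespace false

namespace Summit.ABC.ABC.Theorems

open Real Filter

/-- **Upper edge of the window.** If `0 < p ≤ Y = (M/N^κ)^{1/(2κ−6)}` (`κ > 3`), the twist by
`p` satisfies the lower size condition of the window: `(N p²)^κ ≤ p⁶ M`. -/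
theorem TwistAmplificationLemma.upper_edge {κ N M p : ℝ} (hκ : 3 < κ) (hN : 0 < N) (hM : 0 ≤ M)
    (hp : 0 < p) (hpY : p ≤ (M / N ^ κ) ^ (1 / (2 * κ - 6))) : (N * p ^ 2) ^ κ ≤ p ^ 6 * M := by
  have he : (0 : ℝ) < 2 * κ - 6 := by linarith
  have hNκ : 0 < N ^ κ := Real.rpow_pos_of_pos hN κ
  have hq : 0 ≤ M / N ^ κ := div_nonneg hM hNκ.le
  have h1 : p ^ (2 * κ - 6) ≤ M / N ^ κ := by
    calc p ^ (2 * κ - 6) ≤ ((M / N ^ κ) ^ (1 / (2 * κ - 6))) ^ (2 * κ - 6) :=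
          Real.rpow_le_rpow hp.le hpY he.le
      _ = M / N ^ κ := by rw [one_div, Real.rpow_inv_rpow hq he.ne']
  have e1 : (N * p ^ 2) ^ κ = N ^ κ * (p ^ (2 * κ - 6) * p ^ 6) := by
    rw [Real.mul_rpow hN.le (by positivity)]
    congr 1
    rw [show ((p ^ 2 : ℝ)) = p ^ (2 : ℝ) by norm_num, ← Real.rpow_mul hp.le,
      show (p ^ 6 : ℝ) = p ^ (6 : ℝ) by norm_num, ← Real.rpow_add hp]
    congr 1; ring
  rw [e1]
  calc N ^ κ * (p ^ (2 * κ - 6) * p ^ 6) ≤ N ^ κ * (M / N ^ κ * p ^ 6) := by gcongr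
    _ = p ^ 6 * M := by field_simp

/-- **Lower edge of the window.** If `p ≥ Y₁ = (M/N^σ)^{1/(2σ−6)}` (`σ > 3`, `p > 0`), the twist
by `p` satisfies the upper size condition of the window: `p⁶ M ≤ (N p²)^σ`. -/
theorem TwistAmplificationLemma.lower_edge {σ N M p : ℝ} (hσ : 3 < σ) (hN : 0 < N) (hM : 0 ≤ M)
    (hp : 0 < p) (hpY : (M / N ^ σ) ^ (1 / (2 * σ - 6)) ≤ p) : p ^ 6 * M ≤ (N * p ^ 2) ^ σ := by
  have he : (0 : ℝ) < 2 * σ - 6 := by linarith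
  have hNσ : 0 < N ^ σ := Real.rpow_pos_of_pos hN σ
  have hq : 0 ≤ M / N ^ σ := div_nonneg hM hNσ.le
  have h1 : M / N ^ σ ≤ p ^ (2 * σ - 6) := by
    calc M / N ^ σ = ((M / N ^ σ) ^ (1 / (2 * σ - 6))) ^ (2 * σ - 6) := by
          rw [one_div, Real.rpow_inv_rpow hq he.ne']
      _ ≤ p ^ (2 * σ - 6) := Real.rpow_le_rpow (Real.rpow_nonneg hq _) hpY he.le
  have e1 : (N * p ^ 2) ^ σ = N ^ σ * (p ^ (2 * σ - 6) * p ^ 6) := by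
    rw [Real.mul_rpow hN.le (by positivity)]
    congr 1
    rw [show ((p ^ 2 : ℝ)) = p ^ (2 : ℝ) by norm_num, ← Real.rpow_mul hp.le,
      show (p ^ 6 : ℝ) = p ^ (6 : ℝ) by norm_num, ← Real.rpow_add hp]
    congr 1; ring
  rw [e1]
  calc p ^ 6 * M = N ^ σ * (M / N ^ σ * p ^ 6) := by field_simp
    _ ≤ N ^ σ * (p ^ (2 * σ - 6) * p ^ 6) := by gcongr

/-- **The twist range is wide.** For `3 < κ < σ`, `N ≥ 1` and `M ≥ N^σ`:
`N^{(σ−κ)/(2κ−6)} · (M/N^σ)^{1/(2σ−6)} ≤ (M/N^κ)^{1/(2κ−6)}` (write `M = N^σ u`, `u ≥ 1`; both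
sides are `N^{(σ−κ)/(2κ−6)} u^{a}` with `a = 1/(2σ−6) ≤ 1/(2κ−6)`). -/
theorem TwistAmplificationLemma.separation {κ σ N M : ℝ} (hκ : 3 < κ) (hκσ : κ < σ) (hN : 1 ≤ N)
    (hM : N ^ σ ≤ M) :
    N ^ ((σ - κ) / (2 * κ - 6)) * (M / N ^ σ) ^ (1 / (2 * σ - 6)) ≤
      (M / N ^ κ) ^ (1 / (2 * κ - 6)) := by
  have hN0 : 0 < N := by linarith
  have heκ : (0 : ℝ) < 2 * κ - 6 := by linarith
  have heσ : (0 : ℝ) < 2 * σ - 6 := by linarith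
  have hNσ : 0 < N ^ σ := Real.rpow_pos_of_pos hN0 σ
  have hNκ : 0 < N ^ κ := Real.rpow_pos_of_pos hN0 κ
  set u : ℝ := M / N ^ σ with hu
  have hu1 : 1 ≤ u := by rw [hu, one_le_div hNσ]; exact hM
  have hMeq : M / N ^ κ = N ^ (σ - κ) * u := by
    rw [hu, Real.rpow_sub hN0]
    field_simp
  have hNsk : 0 ≤ N ^ (σ - κ) := (Real.rpow_pos_of_pos hN0 _).le
  rw [hMeq, Real.mul_rpow hNsk (by linarith), ← Real.rpow_mul hN0.le,
    show (σ - κ) * (1 / (2 * κ - 6)) = (σ - κ) / (2 * κ - 6) by ring]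
  exact mul_le_mul_of_nonneg_left
    (Real.rpow_le_rpow_of_exponent_le hu1 (one_div_le_one_div_of_le heκ (by linarith)))
    (Real.rpow_pos_of_pos hN0 _).le

/-- **The top of the twist range is large.** For `3 < κ < σ'`, `N ≥ 1`, `M ≥ N^{σ'}`:
`N^{(σ'−κ)/(2κ−6)} ≤ (M/N^κ)^{1/(2κ−6)}`. -/
theorem TwistAmplificationLemma.rpow_le_upper {κ σ' N M : ℝ} (hκ : 3 < κ) (hN : 1 ≤ N)
    (hM : N ^ σ' ≤ M) :
    N ^ ((σ' - κ) / (2 * κ - 6)) ≤ (M / N ^ κ) ^ (1 / (2 * κ - 6)) := by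
  have hN0 : 0 < N := by linarith
  have heκ : (0 : ℝ) < 2 * κ - 6 := by linarith
  have hNκ : 0 < N ^ κ := Real.rpow_pos_of_pos hN0 κ
  have hq : N ^ (σ' - κ) ≤ M / N ^ κ := by
    rw [Real.rpow_sub hN0]
    exact div_le_div_of_nonneg_right hM hNκ.le
  calc N ^ ((σ' - κ) / (2 * κ - 6)) = (N ^ (σ' - κ)) ^ (1 / (2 * κ - 6)) := by
        rw [← Real.rpow_mul hN0.le]; congr 1; ring
    _ ≤ (M / N ^ κ) ^ (1 / (2 * κ - 6)) :=
        Real.rpow_le_rpow (Real.rpow_pos_of_pos hN0 _).le hq (by positivity)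

/-- **The conductor is a bounded power of the top of the range.** For `3 < κ < σ'`, `N ≥ 1`,
`M ≥ N^{σ'}` and `Y = (M/N^κ)^{1/(2κ−6)}`: `N ≤ Y^{(2κ−6)/(σ'−κ)}` (from `Y^{2κ−6} = M/N^κ ≥
N^{σ'−κ}`). -/
theorem TwistAmplificationLemma.base_le_rpow_upper {κ σ' N M : ℝ} (hκ : 3 < κ) (hκσ' : κ < σ')
    (hN : 1 ≤ N) (hM : N ^ σ' ≤ M) :
    N ≤ ((M / N ^ κ) ^ (1 / (2 * κ - 6))) ^ ((2 * κ - 6) / (σ' - κ)) := by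
  have hN0 : 0 < N := by linarith
  have heκ : (0 : ℝ) < 2 * κ - 6 := by linarith
  have hs : (0 : ℝ) < σ' - κ := by linarith
  have hNκ : 0 < N ^ κ := Real.rpow_pos_of_pos hN0 κ
  have hq0 : 0 ≤ M / N ^ κ := div_nonneg (le_trans (Real.rpow_pos_of_pos hN0 _).le hM) hNκ.le
  have hq : N ^ (σ' - κ) ≤ M / N ^ κ := by
    rw [Real.rpow_sub hN0]
    exact div_le_div_of_nonneg_right hM hNκ.le
  rw [← Real.rpow_mul hq0, show 1 / (2 * κ - 6) * ((2 * κ - 6) / (σ' - κ)) = 1 / (σ' - κ) by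
    field_simp]
  calc N = (N ^ (σ' - κ)) ^ (1 / (σ' - κ)) := by
        rw [one_div, Real.rpow_rpow_inv hN0.le hs.ne']
    _ ≤ (M / N ^ κ) ^ (1 / (σ' - κ)) :=
        Real.rpow_le_rpow (Real.rpow_pos_of_pos hN0 _).le hq (by positivity)

/-- **The conductor scale is a bounded power of the top of the range.** With the notation of
`base_le_rpow_upper`: `X := N Y² ≤ Y^{(2κ−6)/(σ'−κ) + 2}`. -/
theorem TwistAmplificationLemma.scale_le_rpow_upper {κ σ' N M : ℝ} (hκ : 3 < κ) (hκσ' : κ < σ')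
    (hN : 1 ≤ N) (hM : N ^ σ' ≤ M) :
    N * ((M / N ^ κ) ^ (1 / (2 * κ - 6))) ^ 2 ≤
      ((M / N ^ κ) ^ (1 / (2 * κ - 6))) ^ ((2 * κ - 6) / (σ' - κ) + 2) := by
  have h1 := TwistAmplificationLemma.base_le_rpow_upper hκ hκσ' hN hM
  have hY1 : 1 ≤ (M / N ^ κ) ^ (1 / (2 * κ - 6)) :=
    le_trans (Real.one_le_rpow hN (by apply div_nonneg <;> linarith))
      (TwistAmplificationLemma.rpow_le_upper hκ hN hM)
  set Y := (M / N ^ κ) ^ (1 / (2 * κ - 6)) with hY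
  have hY0 : 0 < Y := by linarith
  rw [Real.rpow_add hY0, show Y ^ (2 : ℝ) = Y ^ 2 by norm_num]
  exact mul_le_mul_of_nonneg_right h1 (by positivity)

/-- **The transported saving exponent is below one.** For `3 < κ < σ < σ'` and
`δ < (σ−κ)/(2σ−6)`: `max δ 0 · ((2κ−6)/(σ'−κ) + 2) < 1`; indeed `(2κ−6)/(σ'−κ) + 2 =
(2σ'−6)/(σ'−κ)` and `(σ−κ)/(2σ−6) ≤ (σ'−κ)/(2σ'−6)` because `s ↦ (s−κ)/(2s−6)` is increasing
for `κ > 3`. -/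
theorem TwistAmplificationLemma.saving_exponent_lt_one {κ σ σ' δ : ℝ} (hκ : 3 < κ) (hκσ : κ < σ)
    (hσσ' : σ < σ') (hδ : δ < (σ - κ) / (2 * σ - 6)) :
    max δ 0 * ((2 * κ - 6) / (σ' - κ) + 2) < 1 := by
  have hs : (0 : ℝ) < σ' - κ := by linarith
  have heσ : (0 : ℝ) < 2 * σ - 6 := by linarith
  have hν : (2 * κ - 6) / (σ' - κ) + 2 = (2 * σ' - 6) / (σ' - κ) := by
    field_simp; ring
  have hν0 : 0 < (2 * σ' - 6) / (σ' - κ) := div_pos (by linarith) hs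
  rw [hν]
  rcases le_or_gt δ 0 with hδ0 | hδ0
  · rw [max_eq_right hδ0, zero_mul]; exact one_pos
  rw [max_eq_left hδ0.le]
  have hkey : (σ - κ) / (2 * σ - 6) * ((2 * σ' - 6) / (σ' - κ)) ≤ 1 := by
    rw [div_mul_div_comm, div_le_one (mul_pos heσ hs)]
    nlinarith [mul_pos (sub_pos.2 hκ) (sub_pos.2 hσσ')]
  calc δ * ((2 * σ' - 6) / (σ' - κ)) < (σ - κ) / (2 * σ - 6) * ((2 * σ' - 6) / (σ' - κ)) :=
        mul_lt_mul_of_pos_right hδ hν0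
    _ ≤ 1 := hkey

/-- **Few large divisors.** For `Y ≥ 64` and `2 e ≤ E`: `Y^e ≤ (Y/8)^E` (as `Y/8 ≥ Y^{1/2}`);
used with `N ≤ Y^e` to bound by `E` the number of twisting primes `p > Y/8` dividing the
conductor `N`. -/
theorem TwistAmplificationLemma.rpow_le_div_eight_pow {Y e : ℝ} {E : ℕ} (hY : 64 ≤ Y)
    (hE : 2 * e ≤ E) : Y ^ e ≤ (Y / 8) ^ E := by
  have hY0 : 0 < Y := by linarith
  have hY1 : 1 ≤ Y := by linarith
  have h8 : (8 : ℝ) ≤ Y ^ (1 / 2 : ℝ) := by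
    have h : (64 : ℝ) ^ (1 / 2 : ℝ) ≤ Y ^ (1 / 2 : ℝ) :=
      Real.rpow_le_rpow (by norm_num) hY (by norm_num)
    have e64 : (64 : ℝ) ^ (1 / 2 : ℝ) = 8 := by
      rw [show (64 : ℝ) = 8 ^ (2 : ℝ) by norm_num, ← Real.rpow_mul (by norm_num)]
      norm_num
    linarith
  have hhalf : Y ^ (1 / 2 : ℝ) ≤ Y / 8 := by
    rw [le_div_iff₀ (by norm_num)]
    calc Y ^ (1 / 2 : ℝ) * 8 ≤ Y ^ (1 / 2 : ℝ) * Y ^ (1 / 2 : ℝ) := by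
          gcongr
      _ = Y := by rw [← Real.rpow_add hY0]; norm_num
  calc Y ^ e ≤ Y ^ ((1 / 2 : ℝ) * E) :=
        Real.rpow_le_rpow_of_exponent_le hY1 (by linarith)
    _ = (Y ^ (1 / 2 : ℝ)) ^ E := Real.rpow_mul_natCast hY0.le _ _
    _ ≤ (Y / 8) ^ E := pow_le_pow_left₀ (Real.rpow_nonneg hY0.le _) hhalf E

/-- **Growth.** For `0 ≤ λ < 1`, `E, C ≥ 0`: eventually `(E + C Y^λ) · 8 log Y < Y`
(`log Y = o(Y^ε)` with `ε = (1−λ)/2`). -/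
theorem TwistAmplificationLemma.eventually_count_lt {lam E C : ℝ} (hlam0 : 0 ≤ lam) (hlam : lam < 1)
    (hE : 0 ≤ E) (hC : 0 ≤ C) :
    ∀ᶠ Y : ℝ in atTop, (E + C * Y ^ lam) * (8 * Real.log Y) < Y := by
  have hε : 0 < (1 - lam) / 2 := by linarith
  set c : ℝ := 1 / (16 * (E + C + 1)) with hc
  have hc0 : 0 < c := by positivity
  have hlog := (isLittleO_log_rpow_atTop hε).bound hc0
  filter_upwards [hlog, eventually_ge_atTop (1 : ℝ)] with Y hY hY1
  have hY0 : 0 < Y := by linarith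
  have hlogY : 0 ≤ Real.log Y := Real.log_nonneg hY1
  rw [Real.norm_of_nonneg hlogY, Real.norm_of_nonneg (Real.rpow_nonneg hY0.le _)] at hY
  have hYlam : 1 ≤ Y ^ lam := Real.one_le_rpow hY1 hlam0
  have h1 : E + C * Y ^ lam ≤ (E + C) * Y ^ lam := by nlinarith
  have h2 : Y ^ lam * Y ^ ((1 - lam) / 2) ≤ Y := by
    rw [← Real.rpow_add hY0]
    calc Y ^ (lam + (1 - lam) / 2) ≤ Y ^ (1 : ℝ) :=
          Real.rpow_le_rpow_of_exponent_le hY1 (by linarith)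
      _ = Y := Real.rpow_one Y
  calc (E + C * Y ^ lam) * (8 * Real.log Y) ≤ ((E + C) * Y ^ lam) * (8 * (c * Y ^ ((1 - lam) / 2))) := by
        gcongr
    _ = 8 * c * (E + C) * (Y ^ lam * Y ^ ((1 - lam) / 2)) := by ring
    _ ≤ 8 * c * (E + C) * Y := by gcongr
    _ = (E + C) / (2 * (E + C + 1)) * Y := by rw [hc]; field_simp; ring
    _ < Y := by
        have : (E + C) / (2 * (E + C + 1)) < 1 := by
          rw [div_lt_one (by positivity)]; linarith
        nlinarith

end Summit.ABC.ABC.Theorems
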